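import Literature.AlgebraicGeometry.HodgeTheory.HodgeFramesOfHolomorphicSubbundles
import Mathlib.LinearAlgebra.Matrix.Nondegenerate
import Mathlib.LinearAlgebra.Dual.Lemmas
import HarnessLib

/-!
# Analytic frames of the orthogonal complement of an analytically moving frame

Family `hodge`, layer `Literature/AlgebraicGeometry/HodgeTheory`; proof file (theorems only, no
definition, no named fact). Written by the prover seat `hodge-nonav-prover-Ax` (g11, cell `hodge-nonav`)
for the programme «GRIFFITHS-SURFACES» (route `HodgeConjecture/CyclicUnitaryPowers`).

Linear algebra and elementary several complex variables behind "the orthogonal complement, for a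
constant non-degenerate pairing, of a holomorphic subbundle is a holomorphic subbundle": the step
`F¹𝓗² = (F²𝓗²)^⊥` (first Hodge–Riemann relation, `HodgeStructurePolarizationFiltrationOrthogonal`)
by which Griffiths' holomorphy of the Hodge bundles of a family of SURFACES reduces to that of
`F² = H^{2,0}`.

* `exists_analyticFrame_orthogonal` — let `M` be a finite-dimensional complex vector space with a
  bilinear form `B` which is separating on the right (`B(·, y) = 0 ⇒ y = 0`), `D` an open set of a
  complex normed space, and `w i z` (`i < r`) vectors of `M` depending analytically on `z ∈ D`
  (through all linear functionals) and linearly independent at `z₁ ∈ D`. Then on an open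
  neighbourhood `D' ⊆ D` of `z₁` there are vectors `e k z` (`k < m`), analytic in `z`, linearly
  independent, whose span is EXACTLY the orthogonal `{x | ∀ i, B(x, w i z) = 0}` for every `z ∈ D'`.
  Construction ("graph coordinates"): `K₁` the orthogonal at `z₁`, `C` a complement, `c j ∈ C` the
  dual vectors `B(c j, w i z₁) = δ_{ij}` (the evaluation map `C → ℂʳ` is bijective: injective as
  `C ∩ K₁ = 0`, surjective because the functionals `B(·, w i z₁)` are linearly independent —
  right-separation), `A(z)_{ij} = B(c j, w i z)` (analytic, `A(z₁) = 1`, so invertible near `z₁`,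
  `analyticOnNhd_matrix_inv`), and `e k z = u k − Σ_j (A(z)⁻¹ b_k(z))_j c j` for a basis `u k` of `K₁`,
  `b_k(z)_i = B(u k, w i z)`.

## References

* [VoisinHodgeI2002] C. Voisin, Hodge Theory and Complex Algebraic Geometry I, CUP (2002), §10.2.1
  (holomorphic subbundles and their frames), §7.1.2 (first Hodge–Riemann relation).
* [GriffithsHarris1978] P. Griffiths, J. Harris, Principles of Algebraic Geometry, Wiley 1978, Ch. 0 §5
  (holomorphic vector bundles: kernels of surjective holomorphic bundle maps are subbundles).
-/

noncomputable section

open _root_.Topology _root_.Filter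

namespace Literature.AlgebraicGeometry.HodgeTheory

section HodgeTheory

section OrthogonalFrame

variable {M : Type*} [AddCommGroup M] [Module ℂ M] [FiniteDimensional ℂ M]
  {E' : Type*} [NormedAddCommGroup E'] [NormedSpace ℂ E'] {D : Set E'}

/-- **Analytic frames of the orthogonal complement of an analytically moving frame** (see the module
docstring): for `B` right-separating, `w i z` (`i < r`) analytic on the open `D` and linearly
independent at `z₁`, there are, on an open `D' ∋ z₁` inside `D`, analytic vectors `e k z` (`k < m`),
linearly independent, with `span {e k z} = {x | ∀ i, B(x, w i z) = 0}` for every `z ∈ D'`.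
[cite: VoisinHodgeI2002, §10.2.1] [cite: GriffithsHarris1978, Ch. 0 §5] -/
theorem exists_analyticFrame_orthogonal (B : LinearMap.BilinForm ℂ M) (hB : B.SeparatingRight)
    (hD : IsOpen D) {z₁ : E'} (hz₁ : z₁ ∈ D) {r : ℕ} (w : Fin r → E' → M)
    (hwli : LinearIndependent ℂ (fun i ↦ w i z₁))
    (hwhol : ∀ i (φ : Module.Dual ℂ M), AnalyticOnNhd ℂ (fun z ↦ φ (w i z)) D) :
    ∃ D' : Set E', IsOpen D' ∧ z₁ ∈ D' ∧ D' ⊆ D ∧ ∃ (m : ℕ) (e : Fin m → E' → M),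
      (∀ z ∈ D', LinearIndependent ℂ (fun k ↦ e k z)) ∧
      (∀ z ∈ D', ∀ x : M,
        x ∈ Submodule.span ℂ (Set.range fun k ↦ e k z) ↔ ∀ i, B x (w i z) = 0) ∧
      (∀ k (φ : Module.Dual ℂ M), AnalyticOnNhd ℂ (fun z ↦ φ (e k z)) D') := by
  classical
  -- the evaluation maps `Λ z : x ↦ (B x (w i z))_i` and their kernels
  set Λ : E' → (M →ₗ[ℂ] (Fin r → ℂ)) := fun z ↦ LinearMap.pi fun i ↦ B.flip (w i z) with hΛ
  have hΛapply : ∀ z x i, Λ z x i = B x (w i z) := fun z x i ↦ rfl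
  set K₁ : Submodule ℂ M := LinearMap.ker (Λ z₁) with hK₁
  have hmemK₁ : ∀ x, x ∈ K₁ ↔ ∀ i, B x (w i z₁) = 0 := by
    intro x
    rw [hK₁, LinearMap.mem_ker]
    exact ⟨fun h i ↦ by rw [← hΛapply, h]; rfl, fun h ↦ funext fun i ↦ h i⟩
  -- (A) `Λ z₁` is surjective: the functionals `B(·, w i z₁)` are linearly independent
  have hsurj : Function.Surjective (Λ z₁) := by
    rw [← LinearMap.range_eq_top]
    by_contra hne
    obtain ⟨g, hg0, hg⟩ := (LinearMap.range (Λ z₁)).exists_le_ker_of_lt_top (lt_top_iff_ne_top.2 hne)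
    -- `g v = Σ a_i v_i`
    set a : Fin r → ℂ := fun i ↦ g (Pi.single i 1) with ha
    have hgv : ∀ v : Fin r → ℂ, g v = ∑ i, a i * v i := by
      intro v
      conv_lhs => rw [show v = ∑ i, v i • (Pi.single i 1 : Fin r → ℂ) from by
        ext j; simp [Finset.sum_apply, Pi.single_apply]]
      rw [map_sum]
      exact Finset.sum_congr rfl fun i _ ↦ by rw [map_smul, smul_eq_mul, mul_comm]
    -- `B x (Σ a_i w_i) = 0` for all `x`, hence `Σ a_i w_i = 0`, hence `a = 0`, hence `g = 0`
    have hsum : ∑ i, a i • w i z₁ = 0 := by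
      refine hB _ fun x ↦ ?_
      have hx : g (Λ z₁ x) = 0 := by
        have := hg (LinearMap.mem_range_self (Λ z₁) x)
        rwa [LinearMap.mem_ker] at this
      rw [hgv] at hx
      rw [map_sum]
      simpa only [map_smul, smul_eq_mul, hΛapply] using hx
    have ha0 : ∀ i, a i = 0 := fun i ↦
      Fintype.linearIndependent_iff.1 hwli a hsum i
    refine hg0 (LinearMap.ext fun v ↦ ?_)
    rw [hgv, LinearMap.zero_apply]
    simp [ha0]
  -- (B) a complement `C` of `K₁`; `Λ z₁` restricted to `C` is bijective onto `ℂʳ`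
  obtain ⟨C, hC⟩ := K₁.exists_isCompl
  have hinj : Function.Injective ((Λ z₁).domRestrict C) := by
    intro c c' h
    have hmem : (c : M) - c' ∈ K₁ := by
      rw [hK₁, LinearMap.mem_ker, map_sub, sub_eq_zero]
      exact h
    have h0 : (c : M) - c' = 0 := by
      have := hC.disjoint
      rw [Submodule.disjoint_def] at this
      exact this _ hmem (C.sub_mem c.2 c'.2)
    exact Subtype.ext (sub_eq_zero.1 h0)
  have hsurjC : Function.Surjective ((Λ z₁).domRestrict C) := by
    intro v
    obtain ⟨x, hx⟩ := hsurj v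
    have hxmem : x ∈ K₁ ⊔ C := by rw [hC.sup_eq_top]; exact Submodule.mem_top
    obtain ⟨k, hk, c, hc, rfl⟩ := Submodule.mem_sup.1 hxmem
    refine ⟨⟨c, hc⟩, ?_⟩
    rw [LinearMap.domRestrict_apply]
    have hk0 : Λ z₁ k = 0 := by rwa [hK₁, LinearMap.mem_ker] at hk
    rw [map_add, hk0, zero_add] at hx
    exact hx
  set LC : C ≃ₗ[ℂ] (Fin r → ℂ) := LinearEquiv.ofBijective ((Λ z₁).domRestrict C) ⟨hinj, hsurjC⟩
    with hLC
  have hLCapply : ∀ c : C, LC c = Λ z₁ c := fun c ↦ rfl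
  -- the dual vectors `c j ∈ C`: `B (c j) (w i z₁) = δ_{ij}`
  set c : Fin r → M := fun j ↦ (LC.symm (Pi.single j 1) : C) with hc
  have hcmem : ∀ j, c j ∈ C := fun j ↦ (LC.symm (Pi.single j 1)).2
  have hcdual : ∀ i j, B (c j) (w i z₁) = (Pi.single j (1 : ℂ) : Fin r → ℂ) i := by
    intro i j
    rw [← hΛapply, hc]
    change Λ z₁ ((LC.symm (Pi.single j 1) : C) : M) i = _
    rw [← hLCapply, LinearEquiv.apply_symm_apply]
  -- (C) the matrix `A z` and the good set `D'`
  set A : E' → Matrix (Fin r) (Fin r) ℂ := fun z ↦ Matrix.of fun i j ↦ B (c j) (w i z) with hA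
  have hAapply : ∀ z i j, A z i j = B (c j) (w i z) := fun z i j ↦ rfl
  have hA₁ : A z₁ = 1 := by
    ext i j
    rw [hAapply, hcdual, Matrix.one_apply, Pi.single_apply]
  have hAhol : ∀ i j, AnalyticOnNhd ℂ (fun z ↦ A z i j) D := fun i j ↦ hwhol i (B (c j))
  have hdethol : AnalyticOnNhd ℂ (fun z ↦ (A z).det) D := analyticOnNhd_matrix_det A hAhol
  set D' : Set E' := D ∩ (fun z ↦ (A z).det) ⁻¹' {0}ᶜ with hD'
  have hD'o : IsOpen D' := hdethol.continuousOn.isOpen_inter_preimage hD isOpen_compl_singleton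
  have hz₁D' : z₁ ∈ D' := ⟨hz₁, by
    change (A z₁).det ∈ ({0}ᶜ : Set ℂ)
    rw [hA₁, Matrix.det_one]; exact one_ne_zero⟩
  have hD'D : D' ⊆ D := Set.inter_subset_left
  have hdet : ∀ z ∈ D', (A z).det ≠ 0 := fun z hz ↦ hz.2
  have hinvhol : ∀ i j, AnalyticOnNhd ℂ (fun z ↦ (A z)⁻¹ i j) D' :=
    fun i j ↦ analyticOnNhd_matrix_inv A (fun i j ↦ (hAhol i j).mono hD'D) hdet i j
  -- (D) the frame: `e k z = u k - Σ_j (Matrix.mulVec (A z)⁻¹ (b_k z)) j • c j`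
  set m := Module.finrank ℂ K₁ with hm
  set u : Fin m → M := fun k ↦ (Module.finBasis ℂ K₁ k : K₁) with hu
  have humem : ∀ k, u k ∈ K₁ := fun k ↦ (Module.finBasis ℂ K₁ k).2
  set b : Fin m → E' → (Fin r → ℂ) := fun k z i ↦ B (u k) (w i z) with hb
  set e : Fin m → E' → M := fun k z ↦ u k - ∑ j, (Matrix.mulVec (A z)⁻¹ (b k z)) j • c j with he
  -- the correction term lies in `C`
  have hcorrC : ∀ (d : Fin r → ℂ), ∑ j, d j • c j ∈ C := fun d ↦
    C.sum_mem fun j _ ↦ C.smul_mem _ (hcmem j)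
  -- `c`-expansion of elements of `C`: `y = Σ_j (LC y)_j • c j`
  have hcexp : ∀ y : C, (y : M) = ∑ j, LC y j • c j := by
    intro y
    have h1 : (LC y : Fin r → ℂ) = ∑ j, LC y j • (Pi.single j 1 : Fin r → ℂ) := by
      ext i; simp [Finset.sum_apply, Pi.single_apply]
    have h2 : y = ∑ j, LC y j • LC.symm (Pi.single j 1) := by
      apply LC.injective
      rw [map_sum]
      simp only [map_smul, LinearEquiv.apply_symm_apply]
      exact h1
    conv_lhs => rw [h2]
    rw [Submodule.coe_sum]
    rfl
  -- `B (Σ_j d_j c_j) (w i z) = (Matrix.mulVec (A z) d) i`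
  have hBsum : ∀ (z : E') (d : Fin r → ℂ) (i : Fin r), B (∑ j, d j • c j) (w i z) = (Matrix.mulVec (A z) d) i := by
    intro z d i
    rw [map_sum, LinearMap.sum_apply, Matrix.mulVec, dotProduct]
    refine Finset.sum_congr rfl fun j _ ↦ ?_
    rw [map_smul, LinearMap.smul_apply, smul_eq_mul, hAapply, mul_comm]
  refine ⟨D', hD'o, hz₁D', hD'D, m, e, ?_, ?_, ?_⟩
  · -- linear independence: project to `K₁` along `C`
    intro z hz
    rw [Fintype.linearIndependent_iff]
    intro a ha
    have hsplit : ∑ k, a k • e k z = ∑ k, a k • u k - ∑ j, (∑ k, a k * (Matrix.mulVec (A z)⁻¹ (b k z)) j) • c j := by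
      simp only [he, smul_sub, Finset.sum_sub_distrib, Finset.smul_sum, smul_smul]
      congr 1
      rw [Finset.sum_comm]
      refine Finset.sum_congr rfl fun j _ ↦ ?_
      rw [Finset.sum_smul]
    have hK : ∑ k, a k • u k ∈ K₁ := K₁.sum_mem fun k _ ↦ K₁.smul_mem _ (humem k)
    have hKC : ∑ k, a k • u k ∈ C := by
      have h0 : ∑ k, a k • u k = ∑ j, (∑ k, a k * (Matrix.mulVec (A z)⁻¹ (b k z)) j) • c j := by
        rw [hsplit] at ha
        exact sub_eq_zero.1 ha
      rw [h0]
      exact hcorrC _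
    have hzero : ∑ k, a k • u k = 0 := by
      have := hC.disjoint
      rw [Submodule.disjoint_def] at this
      exact this _ hK hKC
    -- `u` is a basis of `K₁`
    have hli : LinearIndependent ℂ u :=
      (Module.finBasis ℂ K₁).linearIndependent.map' K₁.subtype (Submodule.ker_subtype K₁)
    exact Fintype.linearIndependent_iff.1 hli a hzero
  · -- the span is the orthogonal
    intro z hz x
    have hdetz : (A z).det ≠ 0 := hdet z hz
    -- each `e k z` is orthogonal to every `w i z`
    have heorth : ∀ k i, B (e k z) (w i z) = 0 := by
      intro k i
      rw [he]
      change B (u k - ∑ j, (Matrix.mulVec (A z)⁻¹ (b k z)) j • c j) (w i z) = 0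
      rw [map_sub, LinearMap.sub_apply, hBsum, Matrix.mulVec_mulVec,
        Matrix.mul_nonsing_inv _ (isUnit_iff_ne_zero.2 hdetz), Matrix.one_mulVec]
      exact sub_self _
    constructor
    · intro hx i
      induction hx using Submodule.span_induction with
      | mem y hy =>
        obtain ⟨k, rfl⟩ := hy
        exact heorth k i
      | zero => rw [map_zero, LinearMap.zero_apply]
      | add y y' _ _ hy hy' => rw [map_add, LinearMap.add_apply, hy, hy', add_zero]
      | smul a y _ hy => rw [map_smul, LinearMap.smul_apply, hy, smul_zero]
    · intro hx
      -- decompose `x = xK + xC` along `K₁ ⊕ C`, `xK = Σ a_k u_k`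
      have hxmem : x ∈ K₁ ⊔ C := by rw [hC.sup_eq_top]; exact Submodule.mem_top
      obtain ⟨xK, hxK, xC, hxC, rfl⟩ := Submodule.mem_sup.1 hxmem
      set a : Fin m → ℂ := fun k ↦ (Module.finBasis ℂ K₁).repr ⟨xK, hxK⟩ k with ha
      have hxKexp : xK = ∑ k, a k • u k := by
        have h := (Module.finBasis ℂ K₁).sum_repr ⟨xK, hxK⟩
        have h' := congrArg (fun y : K₁ ↦ (y : M)) h
        simp only [Submodule.coe_sum, Submodule.coe_smul] at h'
        exact h'.symm
      -- `y := x - Σ a_k e_k z` lies in `C` and is orthogonal to every `w i z`, hence `y = 0`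
      set y : M := xK + xC - ∑ k, a k • e k z with hy
      have hyC : y ∈ C := by
        have hsplit : ∑ k, a k • e k z =
            ∑ k, a k • u k - ∑ j, (∑ k, a k * (Matrix.mulVec (A z)⁻¹ (b k z)) j) • c j := by
          simp only [he, smul_sub, Finset.sum_sub_distrib, Finset.smul_sum, smul_smul]
          congr 1
          rw [Finset.sum_comm]
          refine Finset.sum_congr rfl fun j _ ↦ ?_
          rw [Finset.sum_smul]
        rw [hy, hsplit, ← hxKexp, show xK + xC - (xK - ∑ j, (∑ k, a k * (Matrix.mulVec (A z)⁻¹ (b k z)) j) • c j) =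
          xC + ∑ j, (∑ k, a k * (Matrix.mulVec (A z)⁻¹ (b k z)) j) • c j by abel]
        exact C.add_mem hxC (hcorrC _)
      have hyorth : ∀ i, B y (w i z) = 0 := by
        intro i
        rw [hy, map_sub, LinearMap.sub_apply, hx i, map_sum, LinearMap.sum_apply,
          Finset.sum_eq_zero fun k _ ↦ by rw [map_smul, LinearMap.smul_apply, heorth, smul_zero],
          sub_zero]
      have hy0 : y = 0 := by
        set d : Fin r → ℂ := LC ⟨y, hyC⟩ with hd
        have hyexp : y = ∑ j, d j • c j := hcexp ⟨y, hyC⟩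
        have hAd : Matrix.mulVec (A z) d = 0 := by
          funext i
          rw [← hBsum, ← hyexp, hyorth, Pi.zero_apply]
        have hd0 : d = 0 := Matrix.eq_zero_of_mulVec_eq_zero hdetz hAd
        rw [hyexp, hd0]
        simp
      have hxeq : xK + xC = ∑ k, a k • e k z := by
        rw [hy] at hy0
        exact (sub_eq_zero.1 hy0)
      rw [hxeq]
      exact Submodule.sum_mem _ fun k _ ↦
        Submodule.smul_mem _ _ (Submodule.subset_span ⟨k, rfl⟩)
  · -- analyticity
    intro k φ
    have hfun : (fun z ↦ φ (e k z)) =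
        fun z ↦ φ (u k) - ∑ j, (∑ i, (A z)⁻¹ j i * b k z i) * φ (c j) := by
      funext z
      rw [he]
      change φ (u k - ∑ j, (Matrix.mulVec (A z)⁻¹ (b k z)) j • c j) = _
      rw [map_sub, map_sum]
      congr 1
      refine Finset.sum_congr rfl fun j _ ↦ ?_
      rw [map_smul, smul_eq_mul, Matrix.mulVec, dotProduct]
    rw [hfun]
    refine analyticOnNhd_const.sub (Finset.analyticOnNhd_fun_sum _ fun j _ ↦ ?_)
    refine (Finset.analyticOnNhd_fun_sum _ fun i _ ↦ (hinvhol j i).mul ?_).mul analyticOnNhd_const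
    exact (hwhol i (B (u k))).mono hD'D

end OrthogonalFrame

end HodgeTheory

end Literature.AlgebraicGeometry.HodgeTheory

end
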